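import Mathlib.Data.Nat.Factorial.Basic
import Literature.Computability.Complexity.TC0SubsetNC1Reduction
import Literature.Computability.Complexity.NCThreshold
import Literature.Computability.Complexity.ThresholdWeightBound
import HarnessLib

/-!
# `TC⁰ ⊆ NC¹`: discharge of the named fact `TC0_subset_NC1`

This file proves the named fact `TC0_subset_NC1 : TC0 ⊆ NC1` of `ConstantDepth.lean`
(`TC0_subset_NC1_holds`) in the tree's circuit model, by assembling three proved ingredients:

* `TC0SubsetNC1Reduction.lean` — `TC0_subset_NC1_of_gadget`: `TC⁰ ⊆ NC¹` follows once every
  weighted threshold `[θ ≤ ∑ⱼ wⱼ yⱼ]` of `M ≤ N` Boolean variables with ARBITRARY natural weights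
  has a `B₂`-circuit of depth `O(log N)` and polynomial size (gate-by-gate simulation with
  `acWeight`-depth bookkeeping; in the tree's model a majority gate may read a wire many times,
  so the gates of a `TC⁰` circuit are weighted thresholds of their distinct sources);
* `ThresholdWeightBound.lean` — `ThresholdWeights.exists_literal_threshold`: every such threshold
  equals a threshold over the literals `yⱼ ⊕ polⱼ` with natural weights `≤ (M+1)!`
  (Muroga 1971, Thm. 9.3.2.1; Håstad 1994, Thm. 3.2, via a vertex of the polyhedron of
  realizing weights and Cramer's rule);
* `NCThreshold.lean` — `ncVec_wsumGe`: thresholds with weights `< 2^B` in depth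
  `wsumDepth M B = O(log M + log (B + log M))` and size `wsumSize M B` over `B₂` (Vollmer 1999,
  Thm. 1.20, iterated addition by carry-save trees, and Thm. 1.24, `MAJ ∈ DEPTH(log n)`).

With `B = log₂ ((N+1)!) + 1 ≤ (N+2)²` the gadget has depth `≤ 26 · log₂ (N+2) + 39` and size
`≤ 157 · (N+2)⁹` (`ncVec_threshold_logDepth`, `threshold_gadget_depth_bound`,
`threshold_gadget_size_bound`), whence `TC0_subset_NC1_holds`.

## References

* H. Vollmer, *Introduction to Circuit Complexity* (1999), §1.3 Thm. 1.20 and Thm. 1.24, §4.5.2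
  Cor. 4.35 (`AC⁰ ⊊ AC⁰[p] ⊊ TC⁰ ⊆ NC¹`) [Vollmer1999]. (The fact's docstring locator "Cor. 4.41"
  refers to this chain of inclusions.)
* S. Muroga, *Threshold Logic and its Applications* (1971), Thm. 9.3.2.1 [Muroga1971];
  J. Håstad, SIAM J. Discrete Math. 7 (1994), Thm. 3.2 [Hastad1994].
* S. Arora, B. Barak, *Computational Complexity: A Modern Approach* (2009), §14.4.2 and Def. 6.23.
-/

namespace Literature.Computability.Complexity

open Finset

/-! ### The threshold gadget with arbitrary weights -/

/-- **Weighted thresholds with arbitrary natural weights in logarithmic depth over `B₂`.** For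
`M ≤ N`, weights `w : Fin M → ℕ` and a threshold `θ`, the function `y ↦ [θ ≤ ∑ⱼ wⱼ·[yⱼ]]` has a
`B₂`-circuit of depth `1 + wsumDepth N B` and size `N + wsumSize N B`, `B = log₂ ((N+1)!) + 1`:
reduce the weights to naturals `≤ (M+1)! < 2^B` on literals (`exists_literal_threshold`,
Muroga 1971 / Håstad 1994), compute the literals and pad with `N - M` constant-`0` inputs of
weight `0` (one layer), and apply the carry-save threshold circuit `ncVec_wsumGe` on `N` terms
(Vollmer 1999, Thm. 1.20 and Thm. 1.24). [cite: Vollmer1999, Theorem 1.24] -/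
theorem ncVec_threshold_logDepth (N M : ℕ) (hM : M ≤ N) (w : Fin M → ℕ) (θ : ℕ) :
    NCVec (fun (y : Fin M → Bool) (_ : Unit) => decide (θ ≤ ∑ j, w j * (y j).toNat))
      (1 + wsumDepth N (Nat.log 2 (N + 1).factorial + 1))
      (N * 1 + wsumSize N (Nat.log 2 (N + 1).factorial + 1)) := by
  obtain ⟨K, rfl⟩ := Nat.exists_eq_add_of_le hM
  set B := Nat.log 2 (M + K + 1).factorial + 1 with hB
  obtain ⟨c, pol, θ', hc, hthr⟩ := ThresholdWeights.exists_literal_threshold (U := Fin M) w θ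
  -- padded weights: `c` on the `M` literals, `0` on `K` dummy inputs
  let c' : Fin (M + K) → ℕ := Fin.append c (fun _ => 0)
  have hc' : ∀ j, c' j < 2 ^ B := by
    intro j
    induction j using Fin.addCases with
    | left u =>
      simp only [c', Fin.append_left]
      calc c u ≤ (M + 1).factorial := by simpa using hc u
        _ ≤ (M + K + 1).factorial := Nat.factorial_le (by omega)
        _ < 2 ^ B := Nat.lt_pow_succ_log_self one_lt_two _
    | right v =>
      simp only [c', Fin.append_right]
      exact Nat.two_pow_pos B
  -- the layer of literals and dummy zeros: depth `1`, `M + K` gates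
  have hPad : NCVec (fun (y : Fin M → Bool) (j : Fin (M + K)) =>
      Fin.append (fun u => (y u).xor (pol u)) (fun _ => false) j) 1 ((M + K) * 1) := by
    refine NCVec.pi_fin fun j => ?_
    induction j using Fin.addCases with
    | left u =>
      exact (((ncVec_proj fun _ : Unit => u).gate₁ (fun b => b.xor (pol u)) ()).congr
        fun y _ => by simp).mono (by simp) (by simp)
    | right v =>
      exact (ncVec_const false).congr fun y _ => by simp
  have h := hPad.comp (ncVec_wsumGe (M + K) B c' hc' θ')
  refine h.congr fun y _ => ?_
  dsimp only
  rw [hthr y, Fin.sum_univ_add]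
  simp [c']

/-! ### Growth of the gadget -/

/-- `log₂ ((N+1)!) + 1 ≤ (N+2)²` (`(N+1)! ≤ (N+1)^(N+1) < 2^((N+1)²)`). [folklore] -/
theorem log_factorial_succ_le_sq (N : ℕ) : Nat.log 2 (N + 1).factorial + 1 ≤ (N + 2) ^ 2 := by
  have h1 : (N + 1).factorial ≤ (N + 1) ^ (N + 1) := Nat.factorial_le_pow (N + 1)
  have h2 : (N + 1) ^ (N + 1) < (2 ^ (N + 1)) ^ (N + 1) :=
    Nat.pow_lt_pow_left (Nat.lt_two_pow_self) (by omega)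
  have h3 : (N + 1).factorial < 2 ^ ((N + 1) * (N + 1)) := by
    rw [pow_mul]; exact h1.trans_lt h2
  have h4 : Nat.log 2 (N + 1).factorial < (N + 1) * (N + 1) :=
    Nat.log_lt_of_lt_pow (Nat.factorial_ne_zero _) h3
  nlinarith

/-- `⌈log₂ x⌉ ≤ log₂ x + 1`. [folklore] -/
private theorem clog_two_le_log_two_add_one (x : ℕ) : Nat.clog 2 x ≤ Nat.log 2 x + 1 :=
  Nat.clog_le_of_le_pow (Nat.lt_pow_succ_log_self one_lt_two x).le

/-- The working width of the gadget is at most `(N+2)³`. [folklore] -/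
theorem wsumWidth_gadget_le (N : ℕ) :
    wsumWidth N (Nat.log 2 (N + 1).factorial + 1) ≤ (N + 2) ^ 3 := by
  unfold wsumWidth
  have h1 := log_factorial_succ_le_sq N
  have h2 : Nat.clog 2 N ≤ N + 2 := by
    have := clog_two_le_log_two_add_one N
    have := Nat.log_lt_of_lt_pow (b := 2) (by omega : N + 1 ≠ 0)
      (Nat.lt_two_pow_self (n := N + 1))
    have : Nat.log 2 N ≤ Nat.log 2 (N + 1) := Nat.log_mono_right (Nat.le_succ N)
    omega
  calc Nat.log 2 (N + 1).factorial + 1 + Nat.clog 2 N ≤ (N + 2) ^ 2 + (N + 2) := Nat.add_le_add h1 h2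
    _ ≤ (N + 2) ^ 2 * (N + 2) := by nlinarith
    _ = (N + 2) ^ 3 := by ring

/-- `⌈log₂ (x³)⌉ ≤ 3 ⌈log₂ x⌉`. [folklore] -/
theorem clog_two_pow_three_le (x : ℕ) : Nat.clog 2 (x ^ 3) ≤ 3 * Nat.clog 2 x := by
  rw [Nat.clog_le_iff_le_pow one_lt_two, pow_mul']
  exact Nat.pow_le_pow_left (Nat.le_pow_clog one_lt_two _) 3

/-- **The gadget has logarithmic depth**: `1 + wsumDepth N B ≤ 39 · log₂ (N+2) + 39`,
`B = log₂ ((N+1)!) + 1` (indeed `≤ 26 log₂ (N+2) + 39`). [folklore] -/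
theorem threshold_gadget_depth_bound :
    ∃ a : ℕ, ∀ N, 1 + wsumDepth N (Nat.log 2 (N + 1).factorial + 1) ≤ a * Nat.log 2 (N + 2) + a := by
  refine ⟨39, fun N => ?_⟩
  have hW := wsumWidth_gadget_le N
  have h1 : Nat.clog 2 N ≤ Nat.log 2 (N + 2) + 1 :=
    (Nat.clog_mono_right 2 (Nat.le_add_right N 2)).trans (clog_two_le_log_two_add_one _)
  have h2 : Nat.clog 2 (wsumWidth N (Nat.log 2 (N + 1).factorial + 1)) ≤
      3 * (Nat.log 2 (N + 2) + 1) :=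
    calc Nat.clog 2 (wsumWidth N (Nat.log 2 (N + 1).factorial + 1)) ≤ Nat.clog 2 ((N + 2) ^ 3) :=
          Nat.clog_mono_right 2 hW
      _ ≤ 3 * Nat.clog 2 (N + 2) := clog_two_pow_three_le _
      _ ≤ 3 * (Nat.log 2 (N + 2) + 1) := Nat.mul_le_mul_left 3 (clog_two_le_log_two_add_one _)
  unfold wsumDepth
  omega

/-- **The gadget has polynomial size**: `N + wsumSize N B ≤ 157 · (N+2)⁹`,
`B = log₂ ((N+1)!) + 1` (all widths are `≤ (N+2)³`). [folklore] -/
theorem threshold_gadget_size_bound :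
    ∃ q : Polynomial ℕ, ∀ N, N * 1 + wsumSize N (Nat.log 2 (N + 1).factorial + 1) ≤ q.eval N := by
  refine ⟨Polynomial.C 157 * (Polynomial.X + Polynomial.C 2) ^ 9, fun N => ?_⟩
  simp only [Polynomial.eval_mul, Polynomial.eval_C, Polynomial.eval_pow, Polynomial.eval_add,
    Polynomial.eval_X]
  set X := N + 2 with hX
  set V := X ^ 3 with hV
  set W := wsumWidth N (Nat.log 2 (N + 1).factorial + 1) with hWdef
  have hW : W ≤ V := wsumWidth_gadget_le N
  have hN : N ≤ X := by omega
  have hN1 : N - 1 ≤ X := by omega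
  have hstep : N * 1 + wsumSize N (Nat.log 2 (N + 1).factorial + 1) ≤
      X * 1 + ((X * ((V + V) * 1) + X * ((V + V) * 36 + (V + V) * 36)) +
        V * (1 + (V * (V * 1 + V) + V + 1) + 1) + (V * (V * 1 + V) + V + 1)) := by
    unfold wsumSize addBitsSize geConstSize
    rw [← hWdef]
    gcongr
  have hkey : X * 1 + ((X * ((V + V) * 1) + X * ((V + V) * 36 + (V + V) * 36)) +
      V * (1 + (V * (V * 1 + V) + V + 1) + 1) + (V * (V * 1 + V) + V + 1)) =
      X + 146 * (X * V) + 3 * V ^ 2 + 2 * V ^ 3 + 4 * V + 1 := by ring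
  have hX1 : 1 ≤ X := by omega
  have e1 : X * V = X ^ 4 := by rw [hV]; ring
  have e2 : V ^ 2 = X ^ 6 := by rw [hV]; ring
  have e3 : V ^ 3 = X ^ 9 := by rw [hV]; ring
  have b0 : 1 ≤ X ^ 9 := Nat.one_le_pow _ _ hX1
  have b1 : X ≤ X ^ 9 := by
    calc X = X ^ 1 := (pow_one X).symm
      _ ≤ X ^ 9 := Nat.pow_le_pow_right hX1 (by norm_num)
  have b3 : V ≤ X ^ 9 := by rw [hV]; exact Nat.pow_le_pow_right hX1 (by norm_num)
  have b4 : X ^ 4 ≤ X ^ 9 := Nat.pow_le_pow_right hX1 (by norm_num)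
  have b6 : X ^ 6 ≤ X ^ 9 := Nat.pow_le_pow_right hX1 (by norm_num)
  rw [hkey, e1, e2, e3] at hstep
  linarith

/-! ### `TC⁰ ⊆ NC¹` -/

/-- **`TC⁰ ⊆ NC¹`** — discharge of the named fact `TC0_subset_NC1` of `ConstantDepth.lean`
(Vollmer 1999, §4.5.2, Cor. 4.35, via Thm. 1.20 and Thm. 1.24; in the tree's model — majority gates
reading wires with multiplicities — together with the weight bound of Muroga 1971, Thm. 9.3.2.1 /
Håstad 1994, Thm. 3.2): `TC0_subset_NC1_of_gadget` applied to the gadget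
`ncVec_threshold_logDepth` of depth `≤ 39 log₂ (N+2) + 39` and size `≤ 157 (N+2)⁹`.
[cite: Vollmer1999, §4.5.2 Cor. 4.35] -/
theorem TC0_subset_NC1_holds : TC0_subset_NC1 :=
  TC0_subset_NC1_of_gadget (fun N => 1 + wsumDepth N (Nat.log 2 (N + 1).factorial + 1))
    (fun N => N * 1 + wsumSize N (Nat.log 2 (N + 1).factorial + 1))
    (fun N M hM w θ => ncVec_threshold_logDepth N M hM w θ)
    threshold_gadget_depth_bound threshold_gadget_size_bound

end Literature.Computability.Complexity
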